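import Summits.ResolutionOfSingularities.ResolutionOfSingularities.Theorems.EquisingularLiftEquisingularLiftNatBlowupStalkPrescribedChart
import Summits.ResolutionOfSingularities.ResolutionOfSingularities.Theorems.EquisingularLiftEquisingularLiftNatCarrierDeltaComap
import HarnessLib

/-!
# [OURS · L1 W4.5(b) · EL♮(3)] HSUB(ReachTC⁺) brick `inv_base`, part 2c (B6a, T-PRES-UP): the chart-`0` presentation of the UPSTAIRS
# local ring `𝒪_{X₁, j₂ y′}` at the cone point, with the two chart coordinates in the maximal ideal

Crux chain w45b (cell `res-hironaka`, slot W4.5(b)), working crux **EL♮** = stmt-ResolutionOfSingularities-20038, child **EL♮(3)** =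
stmt-ResolutionOfSingularities-20148, route EquisingularLift, line `sections`, registered stub `stub_elnat_tcPlusPointResolution`;
assembly HSUB(ReachTC⁺)₃ (INV DEFS v3 p532383; brick `inv_base`, the CENTRED members: the centred package sits at the cone point
`p_c = j₂ y′` of the stage `X₁`). HONEST FRAMING: OURS; NOT a statement of any manuscript; AI-written, weaker than expert review.
No `sorry`; standard axioms. `--supports stmt-ResolutionOfSingularities-20148 --as helper`. DEF-FREE.

WHAT. In a commuting square `j₂ ≫ τ₁ = υ ≫ j` (the model square of T-ISO-0⁺: `τ₁` a blow-up of `X'` along `J`, `υ` a blow-up of `F₁`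
along the reduced closed point `x`, `(J·𝒪_{X₁})·𝒪_{F₂} = 𝔪_x·𝒪_{F₂}`), with a frame `c` of `J` at `j x` whose image `c̄ = j^♯ c`
generates `𝔪_x`, and res-type-100's T-FRAME-AT presentation of `𝒪_{F₂,y′}` on the chart `c̄₀` in which `c̄₁/c̄₀, c̄₂/c̄₀` vanish at `y′`:
* `exists_blowupAlgebra_stalk_ringEquiv_of_stalkIdeal_eq_span_at` — res-D-pv-029's T-PRES-CHART (p537631) with the frame at a NAMED
  point `p = π x′` (the `stalkCongr` currency of res-type-100 / res-L1-w45b-stub-2's presentation lemmas).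
* **`exists_conePoint_presentation`** — `c₀` generates `(J·𝒪_{X₁})_{j₂ y′}` (its image `ῡ c̄₀` generates the exceptional ideal downstairs,
  a non-zero-divisor, and `j₂^♯` is local), so by T-PRES-CHART the UPSTAIRS local ring `𝒪_{X₁,j₂ y′}` is presented on the chart `c₀`
  of `𝒪_{X',jx}[J/c₀]`; and the chart coordinates `χ(c_l/c₀)`, `l ≠ 0`, lie in `𝔪_{j₂ y′}`: their images under `j₂^♯` are the
  downstairs coordinates `χ̄(c̄_l/c̄₀) ∈ 𝔪_{y′}` (both solve `u · ῡc̄₀ = ῡc̄_l` with `ῡc̄₀` a non-zero-divisor).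
Consumers: B6b/B6c (the axis section and the centred package at `p_c`), res-L1-w45b-stub-2's B5.

References: res-D-pv-029 …NatBlowupStalkPrescribedChart (p537631), …NatCarrierDeltaComap (the `hcoef` transport of a commuting square);
res-type-100 …NatCarrierDeltaFrameAdapted (T-FRAME-AT, p527425).
-/

set_option linter.dupNamespace false -- mandated namespace `Summit.<Summit>.<Problem>` of this single-conjunct summit

noncomputable section

open CategoryTheory CategoryTheory.Limits AlgebraicGeometry TopologicalSpace IsLocalRing
open Literature.AlgebraicGeometry.Resolution
open AlgebraicGeometry.Scheme.IdealSheafData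

namespace Summit.ResolutionOfSingularities.ResolutionOfSingularities.Cruxes.EquisingularLiftNat.Sections

universe u

/-- `(K·𝒪_{X'})_{x'} = K_p · 𝒪_{X',x'}` along the named point `p = f x'` (`stalkIdeal_comap_eq_map_stalkMap` in the `stalkCongr`
currency). [folklore] -/
theorem stalkIdeal_comap_eq_map_of_eq {X Y : Scheme.{u}} (f : X ⟶ Y) (K : Y.IdealSheafData) (x : X) (p : Y) (hp : f x = p) :
    stalkIdeal (K.comap f) x = (stalkIdeal K p).map ((Y.presheaf.stalkCongr (Inseparable.of_eq hp)).inv ≫ f.stalkMap x).hom := by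
  subst hp
  rw [stalkIdeal_comap_eq_map_stalkMap]
  congr 1
  ext a
  simp [TopCat.Presheaf.stalkCongr]

set_option maxHeartbeats 400000 in -- the chart algebra `blowupAlgebra` is a subalgebra of a localisation: slow instance unification (cf. p537631)
/-- **T-PRES-CHART at a named point** (res-D-pv-029's `exists_blowupAlgebra_stalk_ringEquiv_of_stalkIdeal_eq_span`, p537631, with the
frame living at `p = π x′`). [cite: StacksProject, Tag 0804] -/
theorem exists_blowupAlgebra_stalk_ringEquiv_of_stalkIdeal_eq_span_at {X X' : Scheme.{u}} {π : X' ⟶ X} {J : X.IdealSheafData}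
    (hπ : IsBlowup π J) (x' : X') (p : X) (hp : π x' = p) {k : ℕ} (c : Fin k → X.presheaf.stalk p)
    (hc : Ideal.span (Set.range c) = stalkIdeal J p) (j : Fin k)
    (hj : stalkIdeal (J.comap π) x' = Ideal.span {((X.presheaf.stalkCongr (Inseparable.of_eq hp)).inv ≫ π.stalkMap x').hom (c j)}) :
    ∃ (𝔔 : PrimeSpectrum (blowupAlgebra (Ideal.span (Set.range c)) (c j)))
      (χ : blowupAlgebra (Ideal.span (Set.range c)) (c j) →+* X'.presheaf.stalk x')
      (e : X'.presheaf.stalk x' ≃+* Localization.AtPrime 𝔔.asIdeal),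
      (∀ a, χ (algebraMap _ _ a) = ((X.presheaf.stalkCongr (Inseparable.of_eq hp)).inv ≫ π.stalkMap x').hom a) ∧
      @IsLocalization.AtPrime _ _ (X'.presheaf.stalk x') _ χ.toAlgebra 𝔔.asIdeal _ ∧
      (∀ b, e (χ b) = algebraMap _ (Localization.AtPrime 𝔔.asIdeal) b) ∧
      𝔔.asIdeal.comap (algebraMap _ (blowupAlgebra (Ideal.span (Set.range c)) (c j))) = maximalIdeal (X.presheaf.stalk p) := by
  subst hp
  have h0 : ∀ a, ((X.presheaf.stalkCongr (Inseparable.of_eq (rfl : π x' = π x'))).inv ≫ π.stalkMap x').hom a =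
      (π.stalkMap x').hom a := fun a => by simp [TopCat.Presheaf.stalkCongr]
  rw [h0] at hj
  obtain ⟨𝔔, χ, e, hχ, hloc, he, h𝔔⟩ := exists_blowupAlgebra_stalk_ringEquiv_of_stalkIdeal_eq_span hπ x' c hc j hj
  exact ⟨𝔔, χ, e, fun a => (hχ a).trans (h0 a).symm, hloc, he, h𝔔⟩

set_option maxHeartbeats 800000 in -- two chart-algebra presentations (up/down) and the stalk transport of the square (cf. p517803)
/-- **T-PRES-UP: the upstairs local ring at the cone point on the chart `c₀`, chart coordinates in the maximal ideal.** See the module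
docstring. [cite: StacksProject, Tag 0804] -/
theorem exists_conePoint_presentation {X' X₁ F₁ F₂ : Scheme.{0}} [IsLocallyNoetherian X₁] [IsLocallyNoetherian F₂]
    {J : X'.IdealSheafData} {τ₁ : X₁ ⟶ X'} (hτ₁ : IsBlowup τ₁ J) (j : F₁ ⟶ X') {x : F₁} (hx : IsClosed ({x} : Set F₁))
    {υ : F₂ ⟶ F₁} (hυ : IsBlowup υ (vanishingIdeal ⟨{x}, hx⟩)) (j₂ : F₂ ⟶ X₁) (hcomm : j₂ ≫ τ₁ = υ ≫ j)
    (hE : (J.comap τ₁).comap j₂ = (vanishingIdeal ⟨{x}, hx⟩).comap υ)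
    (c : Fin 3 → X'.presheaf.stalk (j x)) (hcJ : Ideal.span (Set.range c) = stalkIdeal J (j x))
    (hcb : Ideal.span (Set.range fun i => (j.stalkMap x).hom (c i)) = maximalIdeal (F₁.presheaf.stalk x))
    (y' : F₂) (hy'x : υ y' = x) (hpc : τ₁ (j₂ y') = j x)
    (Hp : ∃ (𝔔 : PrimeSpectrum (blowupAlgebra (Ideal.span (Set.range fun i => (j.stalkMap x).hom (c i)))
        ((j.stalkMap x).hom (c 0))))
      (χ : blowupAlgebra (Ideal.span (Set.range fun i => (j.stalkMap x).hom (c i))) ((j.stalkMap x).hom (c 0)) →+*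
        F₂.presheaf.stalk y')
      (e : F₂.presheaf.stalk y' ≃+* Localization.AtPrime 𝔔.asIdeal),
      (∀ a, χ (algebraMap _ _ a) = ((F₁.presheaf.stalkCongr (Inseparable.of_eq hy'x)).inv ≫ υ.stalkMap y').hom a) ∧
      @IsLocalization.AtPrime _ _ (F₂.presheaf.stalk y') _ χ.toAlgebra 𝔔.asIdeal _ ∧
      (∀ b, e (χ b) = algebraMap _ (Localization.AtPrime 𝔔.asIdeal) b) ∧
      𝔔.asIdeal.comap (algebraMap _ (blowupAlgebra (Ideal.span (Set.range fun i => (j.stalkMap x).hom (c i)))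
        ((j.stalkMap x).hom (c 0)))) = maximalIdeal (F₁.presheaf.stalk x) ∧
      ∀ (l : {l : Fin 3 // l ≠ 0}) (y : blowupAlgebra (Ideal.span (Set.range fun i => (j.stalkMap x).hom (c i)))
          ((j.stalkMap x).hom (c 0))),
        (y : Localization.Away ((j.stalkMap x).hom (c 0))) =
          algebraMap _ (Localization.Away ((j.stalkMap x).hom (c 0))) ((j.stalkMap x).hom (c l.1)) *
            IsLocalization.Away.invSelf ((j.stalkMap x).hom (c 0)) → y ∈ 𝔔.asIdeal) :
    ∃ (𝔔₁ : PrimeSpectrum (blowupAlgebra (Ideal.span (Set.range c)) (c 0)))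
      (χ₁ : blowupAlgebra (Ideal.span (Set.range c)) (c 0) →+* X₁.presheaf.stalk (j₂ y'))
      (e₁ : X₁.presheaf.stalk (j₂ y') ≃+* Localization.AtPrime 𝔔₁.asIdeal),
      (∀ a, χ₁ (algebraMap _ _ a) = ((X'.presheaf.stalkCongr (Inseparable.of_eq hpc)).inv ≫ τ₁.stalkMap (j₂ y')).hom a) ∧
      @IsLocalization.AtPrime _ _ (X₁.presheaf.stalk (j₂ y')) _ χ₁.toAlgebra 𝔔₁.asIdeal _ ∧
      (∀ b, e₁ (χ₁ b) = algebraMap _ (Localization.AtPrime 𝔔₁.asIdeal) b) ∧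
      𝔔₁.asIdeal.comap (algebraMap _ (blowupAlgebra (Ideal.span (Set.range c)) (c 0))) = maximalIdeal (X'.presheaf.stalk (j x)) ∧
      ∀ l : Fin 3, l ≠ 0 → χ₁ (blowupAlgebra.frac c 0 l) ∈ maximalIdeal (X₁.presheaf.stalk (j₂ y')) := by
  subst hy'x
  -- notation: `τ̃ = τ₁^♯` at the named point `j x`, `φ = ῡ ∘ j^♯ : 𝒪_{X',jx} → 𝒪_{F₂,y′}`
  have hφ : ∀ a : X'.presheaf.stalk (j (υ y')),
      (j₂.stalkMap y').hom (((X'.presheaf.stalkCongr (Inseparable.of_eq hpc)).inv ≫ τ₁.stalkMap (j₂ y')).hom a) =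
        (υ.stalkMap y').hom ((j.stalkMap (υ y')).hom a) := by
    -- adapted from `comap_strictTransformIdeal_sup_comap_eq_of_model` (…NatCarrierDeltaComap, res-D-pv-029), block `hcoef`
    intro a
    have h1 : (j₂ ≫ τ₁).stalkMap y' = (X'.presheaf.stalkCongr (.of_eq (by rw [hcomm]))).hom ≫ (υ ≫ j).stalkMap y' :=
      Scheme.Hom.stalkMap_congr_hom _ _ hcomm y'
    have h2 : ∀ z, (j₂.stalkMap y').hom ((τ₁.stalkMap (j₂ y')).hom z) = ((j₂ ≫ τ₁).stalkMap y').hom z := fun z => by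
      rw [Scheme.Hom.stalkMap_comp]; rfl
    have h3 : ((X'.presheaf.stalkCongr (.of_eq (by rw [hcomm]) : Inseparable ((j₂ ≫ τ₁) y') ((υ ≫ j) y'))).hom)
        ((X'.presheaf.stalkCongr (Inseparable.of_eq hpc)).inv a) = a := by
      change ((X'.presheaf.stalkCongr (Inseparable.of_eq hpc)).inv ≫
        (X'.presheaf.stalkCongr (Inseparable.of_eq hpc)).hom) a = a
      rw [Iso.inv_hom_id]; rfl
    have h4 : ∀ b, ((υ ≫ j).stalkMap y').hom b = (υ.stalkMap y').hom ((j.stalkMap (υ y')).hom b) := fun b => by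
      rw [Scheme.Hom.stalkMap_comp]; rfl
    rw [CommRingCat.comp_apply, h2, h1, CommRingCat.hom_comp, RingHom.comp_apply, ← h4]
    exact congrArg _ h3
  have hυ' : ∀ a, ((F₁.presheaf.stalkCongr (Inseparable.of_eq (rfl : υ y' = υ y'))).inv ≫ υ.stalkMap y').hom a =
      (υ.stalkMap y').hom a := fun a => by simp [TopCat.Presheaf.stalkCongr]
  -- the downstairs presentation
  refine Hp.elim fun 𝔔 H => H.elim fun χ H => H.elim fun e H => ?_
  have hχ : ∀ a, χ (algebraMap _ _ a) = (υ.stalkMap y').hom a := fun a => (H.1 a).trans (hυ' a)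
  have hloc := H.2.1
  have hvan := H.2.2.2.2
  letI := χ.toAlgebra
  haveI : IsLocalization.AtPrime (F₂.presheaf.stalk y') 𝔔.asIdeal := hloc
  -- the downstairs exceptional ideal `𝔪_x · 𝒪_{F₂,y′} = (ῡ c̄₀)`, its generator a non-zero-divisor
  have hEd : stalkIdeal ((vanishingIdeal ⟨{υ y'}, hx⟩ : F₁.IdealSheafData).comap υ) y' =
      Ideal.span {(υ.stalkMap y').hom ((j.stalkMap (υ y')).hom (c 0))} := by
    rw [stalkIdeal_comap_eq_map_stalkMap, stalkIdeal_vanishingIdeal_singleton hx, ← hcb,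
      show (υ.stalkMap y').hom = χ.comp (algebraMap _ _) from RingHom.ext fun a => (hχ a).symm, ← Ideal.map_map,
      map_blowupAlgebra_eq_span (Ideal.subset_span ⟨0, rfl⟩ : (j.stalkMap (υ y')).hom (c 0) ∈
        Ideal.span (Set.range fun i => (j.stalkMap (υ y')).hom (c i))), Ideal.map_span, Set.image_singleton]
    rfl
  have ht0 : (υ.stalkMap y').hom ((j.stalkMap (υ y')).hom (c 0)) ∈ nonZeroDivisors (F₂.presheaf.stalk y') := by
    obtain ⟨t, ht, hKt⟩ := hυ.isEffectiveCartier.exists_stalkIdeal_eq_span y'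
    rw [hEd] at hKt
    obtain ⟨w, hw⟩ := Ideal.mem_span_singleton'.mp (hKt ▸ Ideal.mem_span_singleton_self _ :
      (υ.stalkMap y').hom ((j.stalkMap (υ y')).hom (c 0)) ∈ Ideal.span {t})
    rw [← hw]
    exact mul_mem_nonZeroDivisors.mpr ⟨(isUnit_of_span_singleton_eq_of_mul_eq hKt ht hw).mem_nonZeroDivisors, ht⟩
  -- `c₀` generates the upstairs exceptional ideal at `p_c`
  have hE₁ : stalkIdeal (J.comap τ₁) (j₂ y') =
      Ideal.span {((X'.presheaf.stalkCongr (Inseparable.of_eq hpc)).inv ≫ τ₁.stalkMap (j₂ y')).hom (c 0)} := by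
    obtain ⟨g, hg, hEg⟩ := hτ₁.isEffectiveCartier.exists_stalkIdeal_eq_span (j₂ y')
    have hmem : ((X'.presheaf.stalkCongr (Inseparable.of_eq hpc)).inv ≫ τ₁.stalkMap (j₂ y')).hom (c 0) ∈
        stalkIdeal (J.comap τ₁) (j₂ y') := by
      rw [stalkIdeal_comap_eq_map_of_eq τ₁ J (j₂ y') (j (υ y')) hpc, ← hcJ]
      exact Ideal.mem_map_of_mem _ (Ideal.subset_span (Set.mem_range_self 0))
    rw [hEg] at hmem
    obtain ⟨h, hh⟩ := Ideal.mem_span_singleton'.mp hmem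
    -- downstairs: `(j₂^♯ g) = (ῡ c̄₀)` and `ῡ c̄₀ = j₂^♯ h · j₂^♯ g`, so `j₂^♯ h` is a unit
    have hspan : Ideal.span {(j₂.stalkMap y').hom g} =
        Ideal.span {(υ.stalkMap y').hom ((j.stalkMap (υ y')).hom (c 0))} := by
      rw [← hEd, ← hE, stalkIdeal_comap_eq_map_stalkMap, hEg, Ideal.map_span, Set.image_singleton]
    have hmul : (j₂.stalkMap y').hom h * (j₂.stalkMap y').hom g = (υ.stalkMap y').hom ((j.stalkMap (υ y')).hom (c 0)) := by
      rw [← map_mul, hh, hφ]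
    have hcancel : ∀ a b : F₂.presheaf.stalk y', a * (υ.stalkMap y').hom ((j.stalkMap (υ y')).hom (c 0)) =
        b * (υ.stalkMap y').hom ((j.stalkMap (υ y')).hom (c 0)) → a = b := fun a b hab =>
      sub_eq_zero.mp ((mul_right_mem_nonZeroDivisors_eq_zero_iff ht0).mp (by rw [sub_mul, hab, sub_self]))
    have hunit : IsUnit ((j₂.stalkMap y').hom h) := by
      -- `j₂^♯ g = v · ῡc̄₀` and `ῡc̄₀ = j₂^♯h · j₂^♯g = (j₂^♯h · v) · ῡc̄₀` with `ῡc̄₀` a non-zero-divisor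
      obtain ⟨v, hv⟩ := Ideal.mem_span_singleton'.mp (hspan ▸ Ideal.mem_span_singleton_self ((j₂.stalkMap y').hom g))
      have h1 : ((j₂.stalkMap y').hom h * v) * (υ.stalkMap y').hom ((j.stalkMap (υ y')).hom (c 0)) =
          1 * (υ.stalkMap y').hom ((j.stalkMap (υ y')).hom (c 0)) := by
        rw [one_mul, mul_assoc, hv, hmul]
      exact isUnit_iff_exists_inv.mpr ⟨v, hcancel _ _ h1⟩
    have hunit' : IsUnit h := (isUnit_map_iff (j₂.stalkMap y').hom h).mp hunit
    rw [hEg, ← hh]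
    exact (Ideal.span_singleton_mul_left_unit hunit' g).symm
  -- T-PRES-CHART upstairs on the chart `c₀`
  refine (exists_blowupAlgebra_stalk_ringEquiv_of_stalkIdeal_eq_span_at hτ₁ (j₂ y') (j (υ y')) hpc c hcJ 0 hE₁).elim
    fun 𝔔₁ H₁ => H₁.elim fun χ₁ H₁ => H₁.elim fun e₁ H₁ => ?_
  refine ⟨𝔔₁, χ₁, e₁, H₁.1, H₁.2.1, H₁.2.2.1, H₁.2.2.2, fun l hl => ?_⟩
  -- the chart coordinates: `j₂^♯ (χ₁ (c_l/c₀)) = χ (c̄_l/c̄₀) ∈ 𝔪_{y′}`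
  have hup := apply_frac_mul c 0 l χ₁ _ H₁.1
  have hdown := apply_frac_mul (fun i => (j.stalkMap (υ y')).hom (c i)) 0 l χ _ hχ
  have heq : (j₂.stalkMap y').hom (χ₁ (blowupAlgebra.frac c 0 l)) =
      χ (blowupAlgebra.frac (fun i => (j.stalkMap (υ y')).hom (c i)) 0 l) := by
    refine sub_eq_zero.mp ((mul_right_mem_nonZeroDivisors_eq_zero_iff ht0).mp ?_)
    have h1 := congrArg (j₂.stalkMap y').hom hup
    rw [map_mul, hφ, hφ] at h1
    rw [sub_mul, h1, hdown, sub_self]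
  have hfrac : blowupAlgebra.frac (fun i => (j.stalkMap (υ y')).hom (c i)) 0 l ∈ 𝔔.asIdeal :=
    hvan ⟨l, hl⟩ _ (blowupAlgebra.coe_frac _ 0 l)
  have hdown𝔪 : χ (blowupAlgebra.frac (fun i => (j.stalkMap (υ y')).hom (c i)) 0 l) ∈ maximalIdeal (F₂.presheaf.stalk y') :=
    (IsLocalization.AtPrime.to_map_mem_maximal_iff (F₂.presheaf.stalk y') 𝔔.asIdeal _).mpr hfrac
  rw [← heq] at hdown𝔪
  exact (map_mem_nonunits_iff (j₂.stalkMap y').hom _).mp hdown𝔪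

end Summit.ResolutionOfSingularities.ResolutionOfSingularities.Cruxes.EquisingularLiftNat.Sections

end
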